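import Mathlib
import HarnessLib
import Summits.Ventures.LatticeQCDFlow.Scoring.GeometricEnvelopeBlockSumMoments
import Summits.Ventures.LatticeQCDFlow.Scoring.ChainMeanSquareError
import Summits.Ventures.LatticeQCDFlow.Scoring.VarianceOfTheMean
import Summits.Ventures.LatticeQCDFlow.Scoring.ChainTimeAverage

/-!
# The second moment of a block sum is `n σ²_f + O(1)` — not only `O(√n)` — uniformly in the start and
# the block position, under a geometric sup-norm envelope: `|E_{μ₀}[(Σ_{t<n} f̄(X_{s+t}))²] − n σ²_f| ≤ 32 C² A (A+1)/(1−ρ)²`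

HONEST FRAMING: exact (Metropolis-corrected) sampling algorithms for lattice gauge theory;
figures of merit are autocorrelation/cost numbers at stated couplings and volumes; no
continuum-physics claim.

Venture `LatticeQCDFlow` (cell pub-lqcd), topic `Scoring`; FANOUT row 8 (`s0-cpn-nemc`, GEN-20).
NEW WORK of the cell, not a published result; no definition is introduced; nothing is cited as a
fact.  `Scoring/GeometricEnvelopeBlockSumMoments.lean` bounded the bias of the squared block sum by
`C_h² (2A/(1−ρ) + 4 + 4√n)` through the Poisson–martingale decomposition (the `√n` comes from the
cross term `E|M · Δ|`).  The SHARP form below removes the `√n`: expanding the square and using the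
tower property twice (`E_{μ₀}[f̄(X_u) f̄(X_{u+k})] = ∫ (kop κ)^[u] (f̄ · (kop κ)^[k] f̄) dμ₀`,
`Scoring/ChainTimeAverage.chain_twoTime` + `Scoring/ChainBurnIn.chain_expect`), each pair differs from
the stationary autocovariance `γ_k` by at most `16 C² A² ρ^{max(t,t')}` (the envelope applied to
`f̄ · (kop κ)^[k] f̄`, whose sup is `≤ 8 C² A ρ^k`), and `Σ_{t,t'<n} ρ^{max} ≤ (1+ρ)/(1−ρ)²`
(`Scoring/ChainMeanSquareError.sum_sum_max`, `sum_range_odd_mul_pow_le`); the stationary double sum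
`n γ₀ + 2 Σ_{k<n} (n−k−1) γ_{k+1}` (`Scoring/VarianceOfTheMean.sum_sum_dist`) differs from `n σ²_f` by
`2 Σ_{k<n} (k+1) γ_{k+1} + 2n Σ_{j} γ_{n+1+j}`, bounded by `32 C² A ρ/(1−ρ)²` since `|γ_k| ≤ 8 C² A ρ^k`.
This is the any-start, any-position, RATE form of GEN-18's `chain_mse_tendsto_greenKubo`, and the
input of the `1/b²` bias term in the mean-square error of the batch-means estimator
(`Scoring/BatchMeansConsistencyRate.lean`: `E[(σ̂² − σ²_f)²] ≤ K/a + K''/b²`, the `N^{−2/3}` rate at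
`b ∼ N^{1/3}`).  Printed counterpart NAMED ONLY: the bias of non-overlapping batch means
(Glynn–Whitt 1991; Flegal–Jones 2010 §2).

## Content (envelope `|(kop κ)^[t] g − πg| ≤ 2 C_g A ρ^t`, `0 ≤ A`, `0 ≤ ρ < 1`; `|f| ≤ C`
## measurable, `f̄ = f − πf`, `γ_k = autocov κ π f̄ k`; `P_{μ₀}` the chain's path law from ANY `μ₀`)

* `abs_autocov_le_of_geometricEnvelope` — `|γ_k| ≤ 8 C² A ρ^k`;
* `abs_chain_pair_sub_autocov_le_of_envelope` — `|E_{μ₀}[f̄(X_{s+t}) f̄(X_{s+t'})] − γ_{|t−t'|}| ≤ 16 C² A² ρ^{max(t,t')}`;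
* `abs_sum_sum_autocov_dist_sub_le` — `|Σ_{t,t'<n} γ_{|t−t'|} − n σ²_f| ≤ 32 C² A/(1−ρ)²`;
* **`abs_chain_blockSum_sq_sub_le_sharp_of_envelope`** —
  `|E_{μ₀}[(Σ_{t<n} f̄(X_{s+t}))²] − n σ²_f| ≤ 32 C² A (A+1)/(1−ρ)²` for every `μ₀`, `s`, `n`.

NOT CLAIMED: the exact leading constant `−2 Σ_k k γ_k` of the bias; unbounded observables.
-/

noncomputable section

namespace Summit.Ventures.LatticeQCDFlow.Scoring

open MeasureTheory ProbabilityTheory Filter Finset Preorder Literature.Probability.MarkovChains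
open scoped ENNReal Topology

variable {Ω : Type*} [MeasurableSpace Ω]

section Envelope

variable {κ : Kernel Ω Ω} [IsMarkovKernel κ] {π : Measure Ω} [IsProbabilityMeasure π] {A ρ : ℝ}

omit [IsMarkovKernel κ] in
/-- `|γ_k| ≤ 8 C² A ρ^k` for the autocovariances of `f̄ = f − πf` under the envelope. -/
theorem abs_autocov_le_of_geometricEnvelope
    (henv : ∀ (g : Ω → ℝ), Measurable g → ∀ (Cg : ℝ), (∀ x, |g x| ≤ Cg) →
      ∀ (t : ℕ) (x : Ω), |(kop κ)^[t] g x - ∫ y, g y ∂π| ≤ 2 * Cg * (A * ρ ^ t))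
    {f : Ω → ℝ} (hf : Measurable f) {C : ℝ} (hC : ∀ x, |f x| ≤ C) (k : ℕ) :
    |autocov κ π (fun y => f y - ∫ z, f z ∂π) k| ≤ 8 * C ^ 2 * A * ρ ^ k := by
  obtain ⟨hfb, hCfb, hfb0⟩ := centred_observable_bounds π hf hC
  have hdec : ∀ (t : ℕ) (x : Ω), |(kop κ)^[t] (fun y => f y - ∫ z, f z ∂π) x|
      ≤ 2 * (2 * C) * (A * ρ ^ t) :=
    decay_of_geometricEnvelope henv _ hfb (2 * C) hCfb hfb0
  refine (Exactness.GeneralNCMC.abs_autocov_le_of_envelope (κ := κ) (π := π) hCfb hdec k).trans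
    (le_of_eq ?_)
  ring

variable (μ₀ : Measure Ω) [IsProbabilityMeasure μ₀]

omit [IsProbabilityMeasure π] in
/-- **Each pair is within `16 C² A² ρ^{max(t,t')}` of the stationary autocovariance**, from any start:
`|E_{μ₀}[f̄(X_{s+t}) f̄(X_{s+t'})] − γ_{|t−t'|}| ≤ 16 C² A² ρ^{max(t,t')}` (`f̄` any bounded measurable
`π`-centred observable with the envelope bound `|(kop κ)^[k] f̄| ≤ 4 C A ρ^k`, `|f̄| ≤ 2C`). -/
theorem abs_chain_pair_sub_autocov_le_of_envelope
    (henv : ∀ (g : Ω → ℝ), Measurable g → ∀ (Cg : ℝ), (∀ x, |g x| ≤ Cg) →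
      ∀ (t : ℕ) (x : Ω), |(kop κ)^[t] g x - ∫ y, g y ∂π| ≤ 2 * Cg * (A * ρ ^ t))
    (hρ0 : 0 ≤ ρ) (hρ1 : ρ ≤ 1)
    {fb : Ω → ℝ} (hfb : Measurable fb) {C : ℝ} (hC0 : 0 ≤ C) (hCfb : ∀ x, |fb x| ≤ 2 * C)
    (hKfb : ∀ (k : ℕ) (y : Ω), |(kop κ)^[k] fb y| ≤ 2 * (2 * C) * (A * ρ ^ k)) (s t t' : ℕ) :
    |∫ x, fb (x (s + t)) * fb (x (s + t')) ∂(Kernel.trajMeasure (X := fun _ : ℕ => Ω) μ₀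
        (fun n : ℕ => κ.comap (fun h : (i : ↥(Finset.Iic n)) → Ω => h ⟨n, Finset.mem_Iic.2 le_rfl⟩)
          (measurable_pi_apply _)))
      - autocov κ π fb (Nat.dist t t')| ≤ 16 * C ^ 2 * A ^ 2 * ρ ^ (max t t') := by
  set P := Kernel.trajMeasure (X := fun _ : ℕ => Ω) μ₀
      (fun n : ℕ => κ.comap (fun h : (i : ↥(Finset.Iic n)) → Ω => h ⟨n, Finset.mem_Iic.2 le_rfl⟩)
        (measurable_pi_apply _)) with hP
  -- the ordered case `t ≤ t'`
  have hord : ∀ t t', t ≤ t' →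
      |∫ x, fb (x (s + t)) * fb (x (s + t')) ∂P - autocov κ π fb (Nat.dist t t')|
        ≤ 16 * C ^ 2 * A ^ 2 * ρ ^ (max t t') := by
    intro t t' htt'
    obtain ⟨k, rfl⟩ := Nat.exists_eq_add_of_le htt'
    rw [Nat.dist_eq_sub_of_le htt', Nat.add_sub_cancel_left, max_eq_right htt']
    obtain ⟨hKm, hKb⟩ := iterate_kop_bounded_measurable κ hfb hCfb k
    -- `g = fb · K^k fb`, `|g| ≤ 2C · 4CAρ^k`
    have hgm : Measurable fun y => fb y * (kop κ)^[k] fb y := hfb.mul hKm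
    have hgb : ∀ y, |fb y * (kop κ)^[k] fb y| ≤ 2 * C * (2 * (2 * C) * (A * ρ ^ k)) := fun y => by
      rw [abs_mul]; exact mul_le_mul (hCfb y) (hKfb k y) (abs_nonneg _) (by linarith [hC0])
    -- tower twice
    have h1 : ∫ x, fb (x (s + t)) * fb (x (s + (t + k))) ∂P
        = ∫ x, fb (x (s + t)) * (kop κ)^[k] fb (x (s + t)) ∂P := by
      have e : s + (t + k) = s + t + k := by omega
      rw [e]
      exact chain_twoTime κ μ₀ (s + t) hfb hCfb k hfb hCfb
    have h2 : ∫ x, fb (x (s + t)) * (kop κ)^[k] fb (x (s + t)) ∂P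
        = ∫ y, (kop κ)^[s + t] (fun y => fb y * (kop κ)^[k] fb y) y ∂μ₀ :=
      chain_expect κ μ₀ hgm hgb (s + t)
    have hγ : autocov κ π fb k = ∫ y, fb y * (kop κ)^[k] fb y ∂π := rfl
    obtain ⟨hKgm, hKgb⟩ := iterate_kop_bounded_measurable κ hgm hgb (s + t)
    rw [h1, h2, hγ]
    have hsub : ∫ y, (kop κ)^[s + t] (fun y => fb y * (kop κ)^[k] fb y) y ∂μ₀
        - ∫ y, fb y * (kop κ)^[k] fb y ∂π
        = ∫ y, ((kop κ)^[s + t] (fun y => fb y * (kop κ)^[k] fb y) y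
          - ∫ y, fb y * (kop κ)^[k] fb y ∂π) ∂μ₀ := by
      rw [integral_sub (integrable_of_bounded μ₀ hKgm hKgb) (integrable_const _), integral_const,
        probReal_univ, one_smul]
    rw [hsub]
    calc |∫ y, ((kop κ)^[s + t] (fun y => fb y * (kop κ)^[k] fb y) y
            - ∫ y, fb y * (kop κ)^[k] fb y ∂π) ∂μ₀|
        = ‖∫ y, ((kop κ)^[s + t] (fun y => fb y * (kop κ)^[k] fb y) y
            - ∫ y, fb y * (kop κ)^[k] fb y ∂π) ∂μ₀‖ := (Real.norm_eq_abs _).symm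
      _ ≤ 2 * (2 * C * (2 * (2 * C) * (A * ρ ^ k))) * (A * ρ ^ (s + t)) * μ₀.real Set.univ :=
          norm_integral_le_of_norm_le_const (Eventually.of_forall fun y => by
            rw [Real.norm_eq_abs]
            exact henv _ hgm _ hgb (s + t) y)
      _ = 16 * C ^ 2 * A ^ 2 * (ρ ^ k * ρ ^ (s + t)) := by rw [probReal_univ, mul_one]; ring
      _ ≤ 16 * C ^ 2 * A ^ 2 * ρ ^ (t + k) := by
          refine mul_le_mul_of_nonneg_left ?_ (by positivity)
          rw [pow_add ρ s t, show ρ ^ (t + k) = ρ ^ k * ρ ^ t by rw [pow_add]; ring]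
          exact mul_le_mul_of_nonneg_left (mul_le_of_le_one_left (pow_nonneg hρ0 t)
            (pow_le_one₀ hρ0 hρ1)) (pow_nonneg hρ0 k)
  rcases le_total t t' with htt' | ht't
  · exact hord t t' htt'
  · have hsym : ∫ x, fb (x (s + t)) * fb (x (s + t')) ∂P = ∫ x, fb (x (s + t')) * fb (x (s + t)) ∂P :=
      integral_congr_ae (ae_of_all _ fun x => by ring)
    rw [hsym, Nat.dist_comm, max_comm]
    exact hord t' t ht't

/-- **The stationary double sum is `n σ²_f + O(1)`**: with `|γ_k| ≤ 8 C² A ρ^k` (`0 ≤ A`, `0 ≤ ρ < 1`),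
`|Σ_{t,t'<n} γ_{|t−t'|} − n (γ₀ + 2 Σ' k, γ_{k+1})| ≤ 32 C² A/(1−ρ)²`. -/
theorem abs_sum_sum_autocov_dist_sub_le {γ : ℕ → ℝ} {C : ℝ} (hA : 0 ≤ A) (hρ0 : 0 ≤ ρ) (hρ1 : ρ < 1)
    (hγ : ∀ k, |γ k| ≤ 8 * C ^ 2 * A * ρ ^ k) (n : ℕ) :
    |(∑ t ∈ Finset.range n, ∑ t' ∈ Finset.range n, γ (Nat.dist t t'))
        - n * (γ 0 + 2 * ∑' k, γ (k + 1))| ≤ 32 * C ^ 2 * A / (1 - ρ) ^ 2 := by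
  have h1ρ : 0 < 1 - ρ := sub_pos.2 hρ1
  have hK0 : 0 ≤ 8 * C ^ 2 * A := by positivity
  -- summability of the tail
  have hsum : Summable fun k : ℕ => γ (k + 1) :=
    Summable.of_norm_bounded (((summable_geometric_of_lt_one hρ0 hρ1).mul_left
      (8 * C ^ 2 * A * ρ))) fun k => by
        rw [Real.norm_eq_abs]
        refine (hγ (k + 1)).trans (le_of_eq ?_)
        rw [pow_succ]; ring
  rw [sum_sum_dist γ n]
  -- split the series at `n`
  have hsplit : ∑' k, γ (k + 1) = ∑ k ∈ Finset.range n, γ (k + 1) + ∑' j, γ (j + n + 1) := by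
    rw [← Summable.sum_add_tsum_nat_add n hsum]
  have halg : (n : ℝ) * γ 0 + 2 * ∑ t ∈ Finset.range n, ((n : ℝ) - (t + 1)) * γ (t + 1)
      - n * (γ 0 + 2 * ∑' k, γ (k + 1))
      = -(2 * (∑ t ∈ Finset.range n, ((t : ℝ) + 1) * γ (t + 1) + n * ∑' j, γ (j + n + 1))) := by
    have e1 : ∑ t ∈ Finset.range n, ((n : ℝ) - (t + 1)) * γ (t + 1)
        = (n : ℝ) * ∑ t ∈ Finset.range n, γ (t + 1)
          - ∑ t ∈ Finset.range n, ((t : ℝ) + 1) * γ (t + 1) := by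
      rw [Finset.mul_sum, ← Finset.sum_sub_distrib]
      exact Finset.sum_congr rfl fun t _ => by ring
    rw [hsplit, e1]
    ring
  rw [halg, abs_neg, abs_mul, abs_two]
  -- the two pieces
  have hA1 : |∑ t ∈ Finset.range n, ((t : ℝ) + 1) * γ (t + 1)| ≤ 8 * C ^ 2 * A * (ρ / (1 - ρ) ^ 2) := by
    have hnorm : ‖ρ‖ < 1 := by rw [Real.norm_eq_abs, abs_of_nonneg hρ0]; exact hρ1
    have hser := hasSum_coe_mul_geometric_of_norm_lt_one hnorm
    calc |∑ t ∈ Finset.range n, ((t : ℝ) + 1) * γ (t + 1)|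
        ≤ ∑ t ∈ Finset.range n, |((t : ℝ) + 1) * γ (t + 1)| := Finset.abs_sum_le_sum_abs _ _
      _ ≤ ∑ t ∈ Finset.range n, 8 * C ^ 2 * A * ((((t + 1 : ℕ) : ℝ)) * ρ ^ (t + 1)) :=
          Finset.sum_le_sum fun t _ => by
            rw [abs_mul, abs_of_nonneg (by positivity : (0 : ℝ) ≤ (t : ℝ) + 1)]
            calc ((t : ℝ) + 1) * |γ (t + 1)| ≤ ((t : ℝ) + 1) * (8 * C ^ 2 * A * ρ ^ (t + 1)) :=
                  mul_le_mul_of_nonneg_left (hγ _) (by positivity)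
              _ = 8 * C ^ 2 * A * ((((t + 1 : ℕ) : ℝ)) * ρ ^ (t + 1)) := by push_cast; ring
      _ = 8 * C ^ 2 * A * ∑ t ∈ Finset.range n, (((t + 1 : ℕ) : ℝ)) * ρ ^ (t + 1) := by
          rw [Finset.mul_sum]
      _ ≤ 8 * C ^ 2 * A * (ρ / (1 - ρ) ^ 2) := by
          refine mul_le_mul_of_nonneg_left ?_ hK0
          have hshift : ∑ t ∈ Finset.range n, (((t + 1 : ℕ) : ℝ)) * ρ ^ (t + 1)
              = ∑ j ∈ Finset.range (n + 1), (j : ℝ) * ρ ^ j := by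
            rw [Finset.sum_range_succ' (fun j => (j : ℝ) * ρ ^ j) n]
            simp
          rw [hshift]
          exact sum_le_hasSum _ (fun j _ => by positivity) hser
  have hA2 : |(n : ℝ) * ∑' j, γ (j + n + 1)| ≤ 8 * C ^ 2 * A * (ρ / (1 - ρ) ^ 2) := by
    -- `|Σ' γ_{j+n+1}| ≤ 8C²A ρ^{n+1}/(1−ρ)` and `n ρ^n ≤ 1/(1−ρ)`
    have htail : |∑' j, γ (j + n + 1)| ≤ 8 * C ^ 2 * A * (ρ ^ (n + 1) / (1 - ρ)) := by
      have hg : HasSum (fun j : ℕ => 8 * C ^ 2 * A * ρ ^ (n + 1) * ρ ^ j)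
          (8 * C ^ 2 * A * ρ ^ (n + 1) * (1 - ρ)⁻¹) :=
        (hasSum_geometric_of_lt_one hρ0 hρ1).mul_left _
      have hs2 : Summable fun j : ℕ => γ (j + n + 1) :=
        Summable.of_norm_bounded ((summable_geometric_of_lt_one hρ0 hρ1).mul_left
          (8 * C ^ 2 * A * ρ ^ (n + 1))) fun j => by
            rw [Real.norm_eq_abs]
            refine (hγ _).trans (le_of_eq ?_)
            rw [show j + n + 1 = (n + 1) + j by omega, pow_add]
            ring
      calc |∑' j, γ (j + n + 1)| = ‖∑' j, γ (j + n + 1)‖ := (Real.norm_eq_abs _).symm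
        _ ≤ ∑' j, ‖γ (j + n + 1)‖ := norm_tsum_le_tsum_norm hs2.norm
        _ ≤ ∑' j : ℕ, 8 * C ^ 2 * A * ρ ^ (n + 1) * ρ ^ j := by
            refine Summable.tsum_le_tsum (fun j => ?_) hs2.norm hg.summable
            rw [Real.norm_eq_abs]
            refine (hγ _).trans (le_of_eq ?_)
            rw [show j + n + 1 = (n + 1) + j by omega, pow_add]; ring
        _ = 8 * C ^ 2 * A * (ρ ^ (n + 1) / (1 - ρ)) := by rw [hg.tsum_eq, div_eq_mul_inv]; ring
    have hnρ : (n : ℝ) * ρ ^ n ≤ 1 / (1 - ρ) := by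
      have hle : (n : ℝ) * ρ ^ n ≤ ∑ k ∈ Finset.range n, ρ ^ k := by
        have h := Finset.card_nsmul_le_sum (Finset.range n) (fun k => ρ ^ k) (ρ ^ n) fun k hk =>
          pow_le_pow_of_le_one hρ0 hρ1.le (Finset.mem_range.1 hk).le
        rwa [Finset.card_range, nsmul_eq_mul] at h
      refine hle.trans ?_
      have hg := hasSum_geometric_of_lt_one hρ0 hρ1
      rw [one_div]
      exact sum_le_hasSum _ (fun k _ => pow_nonneg hρ0 k) hg
    rw [abs_mul, Nat.abs_cast]
    calc (n : ℝ) * |∑' j, γ (j + n + 1)| ≤ (n : ℝ) * (8 * C ^ 2 * A * (ρ ^ (n + 1) / (1 - ρ))) :=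
          mul_le_mul_of_nonneg_left htail (Nat.cast_nonneg n)
      _ = 8 * C ^ 2 * A * (ρ / (1 - ρ)) * ((n : ℝ) * ρ ^ n) := by rw [pow_succ]; field_simp; ring
      _ ≤ 8 * C ^ 2 * A * (ρ / (1 - ρ)) * (1 / (1 - ρ)) :=
          mul_le_mul_of_nonneg_left hnρ (by positivity)
      _ = 8 * C ^ 2 * A * (ρ / (1 - ρ) ^ 2) := by field_simp
  have hρle : ρ / (1 - ρ) ^ 2 ≤ 1 / (1 - ρ) ^ 2 :=
    div_le_div_of_nonneg_right hρ1.le (by positivity)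
  calc 2 * |∑ t ∈ Finset.range n, ((t : ℝ) + 1) * γ (t + 1) + (n : ℝ) * ∑' j, γ (j + n + 1)|
      ≤ 2 * (8 * C ^ 2 * A * (ρ / (1 - ρ) ^ 2) + 8 * C ^ 2 * A * (ρ / (1 - ρ) ^ 2)) :=
        mul_le_mul_of_nonneg_left ((abs_add_le _ _).trans (add_le_add hA1 hA2)) zero_le_two
    _ = 32 * C ^ 2 * A * (ρ / (1 - ρ) ^ 2) := by ring
    _ ≤ 32 * C ^ 2 * A * (1 / (1 - ρ) ^ 2) := mul_le_mul_of_nonneg_left hρle (by positivity)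
    _ = 32 * C ^ 2 * A / (1 - ρ) ^ 2 := by ring

/-- **THE SECOND MOMENT OF A BLOCK SUM IS `n σ²_f + O(1)`, UNIFORMLY IN THE START AND THE BLOCK
POSITION, UNDER THE ENVELOPE.**  Envelope `(A, ρ)` (`0 ≤ A`, `0 ≤ ρ < 1`), `|f| ≤ C` measurable; for
EVERY `μ₀`, `s`, `n`:
`|E_{μ₀}[(Σ_{t<n} (f(X_{s+t}) − πf))²] − n σ²_f| ≤ 32 C² A (A+1)/(1−ρ)²`. -/
theorem abs_chain_blockSum_sq_sub_le_sharp_of_envelope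
    (henv : ∀ (g : Ω → ℝ), Measurable g → ∀ (Cg : ℝ), (∀ x, |g x| ≤ Cg) →
      ∀ (t : ℕ) (x : Ω), |(kop κ)^[t] g x - ∫ y, g y ∂π| ≤ 2 * Cg * (A * ρ ^ t))
    (hA : 0 ≤ A) (hρ0 : 0 ≤ ρ) (hρ1 : ρ < 1)
    {f : Ω → ℝ} (hf : Measurable f) {C : ℝ} (hC : ∀ x, |f x| ≤ C) (s n : ℕ) :
    |∫ x, (∑ t ∈ Finset.range n, (f (x (s + t)) - ∫ z, f z ∂π)) ^ 2
        ∂(Kernel.trajMeasure (X := fun _ : ℕ => Ω) μ₀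
          (fun n : ℕ => κ.comap (fun h : (i : ↥(Finset.Iic n)) → Ω => h ⟨n, Finset.mem_Iic.2 le_rfl⟩)
            (measurable_pi_apply _)))
      - n * ((∫ y, (f y - ∫ z, f z ∂π) ^ 2 ∂π)
        + 2 * ∑' k, ∫ y, (f y - ∫ z, f z ∂π) * (kop κ)^[k + 1] (fun y => f y - ∫ z, f z ∂π) y ∂π)|
      ≤ 32 * C ^ 2 * A * (A + 1) / (1 - ρ) ^ 2 := by
  set P := Kernel.trajMeasure (X := fun _ : ℕ => Ω) μ₀
      (fun n : ℕ => κ.comap (fun h : (i : ↥(Finset.Iic n)) → Ω => h ⟨n, Finset.mem_Iic.2 le_rfl⟩)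
        (measurable_pi_apply _)) with hP
  set c := ∫ z, f z ∂π with hc
  obtain ⟨hfb, hCfb, hfb0⟩ := centred_observable_bounds π hf hC
  have hC0 : 0 ≤ C := (abs_nonneg _).trans (hC (Classical.choice (nonempty_of_isProbabilityMeasure π)))
  have h1ρ : 0 < 1 - ρ := sub_pos.2 hρ1
  have hKfb : ∀ (k : ℕ) (y : Ω), |(kop κ)^[k] (fun z => f z - c) y| ≤ 2 * (2 * C) * (A * ρ ^ k) :=
    decay_of_geometricEnvelope henv _ hfb (2 * C) hCfb hfb0
  set γ : ℕ → ℝ := fun k => autocov κ π (fun z => f z - c) k with hγdef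
  have hγ : ∀ k, |γ k| ≤ 8 * C ^ 2 * A * ρ ^ k := fun k =>
    abs_autocov_le_of_geometricEnvelope henv hf hC k
  -- rewrite `σ²` with `γ`
  have hσ : (∫ y, (f y - c) ^ 2 ∂π)
      + 2 * ∑' k, ∫ y, (f y - c) * (kop κ)^[k + 1] (fun y => f y - c) y ∂π
      = γ 0 + 2 * ∑' k, γ (k + 1) := by
    show _ = autocov κ π (fun z => f z - c) 0 + 2 * ∑' k, autocov κ π (fun z => f z - c) (k + 1)
    rw [autocov_zero]
    rfl
  rw [hσ]
  -- expand the square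
  set a : ℕ → (ℕ → Ω) → ℝ := fun t x => f (x (s + t)) - c with ha
  have ham : ∀ t, Measurable (a t) := fun t => hfb.comp (measurable_pi_apply _)
  have hab : ∀ t x, |a t x| ≤ 2 * C := fun t x => hCfb _
  have hiaa : ∀ t t', Integrable (fun x => a t x * a t' x) P := fun t t' =>
    integrable_of_bounded P ((ham t).mul (ham t')) (C := 2 * C * (2 * C)) fun x => by
      rw [abs_mul]; exact mul_le_mul (hab t x) (hab t' x) (abs_nonneg _) (by positivity)
  have hsq : ∀ x : ℕ → Ω, (∑ t ∈ Finset.range n, a t x) ^ 2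
      = ∑ t ∈ Finset.range n, ∑ t' ∈ Finset.range n, a t x * a t' x := fun x => by
    rw [sq, Finset.sum_mul_sum]
  have hE : ∫ x, (∑ t ∈ Finset.range n, a t x) ^ 2 ∂P
      = ∑ t ∈ Finset.range n, ∑ t' ∈ Finset.range n, ∫ x, a t x * a t' x ∂P := by
    rw [integral_congr_ae (ae_of_all _ hsq), integral_finsetSum _ fun t _ =>
      integrable_finsetSum _ fun t' _ => hiaa t t']
    exact Finset.sum_congr rfl fun t _ => integral_finsetSum _ fun t' _ => hiaa t t'
  show |∫ x, (∑ t ∈ Finset.range n, a t x) ^ 2 ∂P - n * (γ 0 + 2 * ∑' k, γ (k + 1))|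
    ≤ 32 * C ^ 2 * A * (A + 1) / (1 - ρ) ^ 2
  rw [hE]
  -- compare with the stationary double sum
  have hpairs : |∑ t ∈ Finset.range n, ∑ t' ∈ Finset.range n, ∫ x, a t x * a t' x ∂P
      - ∑ t ∈ Finset.range n, ∑ t' ∈ Finset.range n, γ (Nat.dist t t')|
      ≤ 16 * C ^ 2 * A ^ 2 * ((1 + ρ) / (1 - ρ) ^ 2) := by
    rw [← Finset.sum_sub_distrib]
    simp_rw [← Finset.sum_sub_distrib]
    calc |∑ t ∈ Finset.range n, ∑ t' ∈ Finset.range n, (∫ x, a t x * a t' x ∂P - γ (Nat.dist t t'))|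
        ≤ ∑ t ∈ Finset.range n, ∑ t' ∈ Finset.range n, |∫ x, a t x * a t' x ∂P - γ (Nat.dist t t')| :=
          (Finset.abs_sum_le_sum_abs _ _).trans (Finset.sum_le_sum fun t _ =>
            Finset.abs_sum_le_sum_abs _ _)
      _ ≤ ∑ t ∈ Finset.range n, ∑ t' ∈ Finset.range n, 16 * C ^ 2 * A ^ 2 * ρ ^ (max t t') :=
          Finset.sum_le_sum fun t _ => Finset.sum_le_sum fun t' _ =>
            abs_chain_pair_sub_autocov_le_of_envelope μ₀ henv hρ0 hρ1.le hfb hC0 hCfb hKfb s t t'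
      _ = ∑ k ∈ Finset.range n, (2 * (k : ℝ) + 1) * (16 * C ^ 2 * A ^ 2 * ρ ^ k) :=
          sum_sum_max (fun k => 16 * C ^ 2 * A ^ 2 * ρ ^ k) n
      _ = 16 * C ^ 2 * A ^ 2 * ∑ k ∈ Finset.range n, (2 * (k : ℝ) + 1) * ρ ^ k := by
          rw [Finset.mul_sum]; exact Finset.sum_congr rfl fun k _ => by ring
      _ ≤ 16 * C ^ 2 * A ^ 2 * ((1 + ρ) / (1 - ρ) ^ 2) :=
          mul_le_mul_of_nonneg_left (sum_range_odd_mul_pow_le hρ0 hρ1 n) (by positivity)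
  have hstat := abs_sum_sum_autocov_dist_sub_le (γ := γ) (C := C) hA hρ0 hρ1 hγ n
  have h1ρ2 : (1 + ρ) / (1 - ρ) ^ 2 ≤ 2 / (1 - ρ) ^ 2 :=
    div_le_div_of_nonneg_right (by linarith) (by positivity)
  calc |∑ t ∈ Finset.range n, ∑ t' ∈ Finset.range n, ∫ x, a t x * a t' x ∂P
        - n * (γ 0 + 2 * ∑' k, γ (k + 1))|
      ≤ |∑ t ∈ Finset.range n, ∑ t' ∈ Finset.range n, ∫ x, a t x * a t' x ∂P
          - ∑ t ∈ Finset.range n, ∑ t' ∈ Finset.range n, γ (Nat.dist t t')|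
        + |(∑ t ∈ Finset.range n, ∑ t' ∈ Finset.range n, γ (Nat.dist t t'))
          - n * (γ 0 + 2 * ∑' k, γ (k + 1))| := abs_sub_le _ _ _
    _ ≤ 16 * C ^ 2 * A ^ 2 * ((1 + ρ) / (1 - ρ) ^ 2) + 32 * C ^ 2 * A / (1 - ρ) ^ 2 :=
        add_le_add hpairs hstat
    _ ≤ 16 * C ^ 2 * A ^ 2 * (2 / (1 - ρ) ^ 2) + 32 * C ^ 2 * A / (1 - ρ) ^ 2 :=
        add_le_add (mul_le_mul_of_nonneg_left h1ρ2
          (by positivity : (0 : ℝ) ≤ 16 * C ^ 2 * A ^ 2)) le_rfl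
    _ = 32 * C ^ 2 * A * (A + 1) / (1 - ρ) ^ 2 := by ring

end Envelope

end Summit.Ventures.LatticeQCDFlow.Scoring

end
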